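import Literature.AlgebraicGeometry.HodgeTheory.AbelianVarietyLefschetzNumbersDoldCongruences
import Literature.Dynamics.FixedPoints.TraceSequenceLinearRecurrence
import HarnessLib

/-!
# The Lefschetz numbers of the iterates of a self-map of `A(ℂ)`, and `F(n) = #Fix(f(ℂ)ⁿ)`, are Lefschetz
# sequences `tr Pⁿ - tr Nⁿ` (Byszewski–Graff–Ward 2021, Def. 5.1), satisfy a monic integral linear recurrence
# of order `4^g`, and `F(n) = Σ_S (-1)^{|S|} α_Sⁿ` (Prop. 5.2)

Lane `lit-hodgefound`, row A1-30⁺²⁰ / (A1-30⁺¹⁹)⁺ / (Q616)⁺ / (Q643)⁺ (prover seat `lit-hodgefound-p31`; FILE B2 of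
the row whose FILE A2 is `Dynamics/FixedPoints/TraceSequenceLinearRecurrence.lean`: the Cayley–Hamilton
recurrence `Σ_j χ_M[j] tr(M^{n+j}) = 0` of a trace sequence, annihilating polynomials of linear combinations,
and the normal form `Σₖ ±tr(Mₖⁿ) = tr(Aⁿ) - tr(Bⁿ)`).

Printed statements.  J. Byszewski, G. Graff, T. Ward, *Dold sequences, periodic points, and dynamics*, Bull.
LMS 53 (2021) (held `paper:arxiv-2007.04031`), §5 (text chunk p0016): **Definition 5.1** «A sequence of integers
`(a_n)` is a Lefschetz sequence if there exist square integer matrices `A` and `B` such that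
`a_n = trace Aⁿ - trace Bⁿ` for all `n ∈ ℕ`»; **Proposition 5.2** «`(a_n)` is a Lefschetz sequence if and only if
there exist algebraic numbers `λ_1, …, λ_s` and integers `m_1, …, m_s` such that `a_n = Σᵢ mᵢ λᵢⁿ` for all
`n ∈ ℕ`»; **Lemma 5.3** «[a power series] represents a rational function `P(z)/Q(z)` … if and only if its
coefficients satisfy a linear recurrence relation. Furthermore, the order of the recurrence is at most
`max(deg P, deg Q)`»; **Theorem 5.4** «`(a_n)` is a Lefschetz sequence if and only if `(a_n)` is a Dold
sequence with the property that its generating sequence `(c_n)` is a linear recurrence sequence»; §2 (chunk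
p0005) «`Λ(f) = Σ_{k ≥ 0} (-1)^k trace(f_*|_{H_k(X,ℚ)})`» (the name: the Lefschetz numbers of the iterates of a
map are the model Lefschetz sequence); M. Alvarado, R. Auffarth (2018), p0003 `F(n) := #Fix(fⁿ)` and
«`F(n) = Δ_n(χ^r_f)` … `Δ_n(Q) := ∏_{i=1}^d (αᵢⁿ - 1)`».

What is formalized (theorems only; no definition, no named fact).  For a complex abelian variety `A` of
dimension `g` and a continuous self-map `φ` of `A(ℂ)`, the matrix `M_k` of `φ^*` on `Hᵏ(A(ℂ); ℤ) ≅ ℤ^{C(2g,k)}`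
(row Q616's compatible bases) is an integer matrix with `Tr((φ^*)ⁿ | Hᵏ(A(ℂ); ℚ)) = tr(M_kⁿ)` and
`χ(φ^* | Hᵏ(A(ℂ); ℚ)) = χ_{M_k}` (`AbelianVariety.exists_matrices_trace_pow_singularCohomology_map_eq`), so that
the Lefschetz numbers `Λ(φⁿ) = Σ_{k ≤ 2g} (-1)^k Tr((φ^*)ⁿ | Hᵏ(A(ℂ); ℚ))` of the iterates satisfy:

* **`AbelianVariety.exists_alternatingSum_trace_pow_eq_trace_pow_sub_trace_pow`** — DEF. 5.1: `Λ(φⁿ) = tr(Pⁿ) -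
  tr(Nⁿ)` for the square integer matrices `P = ⊕_{k even} M_k`, `N = ⊕_{k odd} M_k`, of total size
  `Σ_k C(2g,k) = 4^g`;
* **`AbelianVariety.exists_monic_sum_coeff_mul_alternatingSum_trace_pow_add_eq_zero`** — a monic `P ∈ ℤ[t]` of
  degree `4^g` with `P ⊗ ℚ = ∏_{k ≤ 2g} χ(φ^* | Hᵏ(A(ℂ); ℚ))` and `Σ_{j=0}^{4^g} P_j Λ(φ^{n+j}) = 0` for all `n`
  (a linear recurrence sequence of order `4^g`; the printed route is Prop. 5.2 + Lemma 5.3, here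
  Cayley–Hamilton on each `Hᵏ(A(ℂ); ℤ)`);

and for a `ℂ`-morphism `f : A.X ⟶ A.X`, with `F(n) = #Fix(f(ℂ)^[n]) = Λ(f(ℂ)ⁿ)` (row Q616, `Nat.card`):

* **`AbelianVariety.exists_natCard_fixedPoints_iterate_eq_trace_pow_sub_trace_pow`** (`F(n) = tr(Pⁿ) - tr(Nⁿ)` in
  `ℤ` for all `n`: `F` IS a Lefschetz sequence),
  **`AbelianVariety.exists_monic_sum_coeff_mul_natCard_fixedPoints_iterate_add_eq_zero`**
  (`Σ_{j=0}^{4^g} P_j F(n+j) = 0` in `ℤ`), and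
  **`AbelianVariety.natCard_fixedPoints_iterate_eq_sum_powerset_eigenvalues`** — PROP. 5.2's form:
  `F(n) = Σ_{S} (-1)^{|S|} (∏_{i ∈ S} αᵢ)ⁿ` over the sub-multisets `S` of the eigenvalues `α₁, …, α_{2g}` of
  `f(ℂ)^*` on `H¹(A(ℂ); ℚ)` (expanding `F(n) = ∏ᵢ (1 - αᵢⁿ)`, row Q643).

## References

* [ByszewskiGraffWard2021] J. Byszewski, G. Graff, T. Ward, *Dold sequences, periodic points, and dynamics*,
  Bull. London Math. Soc. 53 (2021) 1263–1298, §5 Def. 5.1, Prop. 5.2, Lemma 5.3, Thm. 5.4; §2 (held text chunks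
  p0016, p0005).
* [AlvaradoAuffarth2018] M. Alvarado, R. Auffarth, *Fixed points of endomorphisms of complex tori*, J. Algebra
  507 (2018), §1 and §3 (arXiv PDF pp. 3, 6).
* [FarmakisMoskowitz2013] I. Farmakis, M. Moskowitz, *Fixed Point Theorems and Their Applications* (2013),
  §5.5.2 (PDF p. 133): `L(f) = Σᵢ (-1)ⁱ Tr(f^{*,i})`.
-/

noncomputable section

open CategoryTheory Module Function Finset Polynomial
open Literature.AlgebraicTopology.SingularHomology Literature.NumberTheory.LFunctions Literature.Dynamics.FixedPoints
open Literature.AlgebraicGeometry.Motives (ComplexPoints AbelianVariety AlgPoints)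

namespace Literature.AlgebraicGeometry.HodgeTheory

section Continuous

variable (A : AbelianVariety ℂ) (φ : C(ComplexPoints A.X, ComplexPoints A.X))

/-- **Integral matrices for `φ^*` on all of `H^•(A(ℂ))` at once**: integer matrices `M_k` (`k ∈ ℕ`), indexed
by the `k`-subsets of `Fin 2g` (size `C(2g, k)`), with `Tr((φ^*)ⁿ | Hᵏ(A(ℂ); ℚ)) = tr(M_kⁿ)` for all `n` and
`χ(φ^* | Hᵏ(A(ℂ); ℚ)) = χ_{M_k} ⊗ ℚ`, for every continuous self-map `φ` of `A(ℂ)` — the matrices of `φ^*` on the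
free groups `Hᵏ(A(ℂ); ℤ)` in bases compatible with `Hᵏ(A(ℂ); ℚ) = Hᵏ(A(ℂ); ℤ) ⊗ ℚ` (row Q568/Q616's
`exists_basis_toMatrix_singularCohomology_map_eq_map_int`). [cite: Lange2023AbelianVarietiesComplex, §1.1.3 (PDF p. 23)]
[cite: ByszewskiGraffWard2021, §5 Def. 5.1 (text chunk p0016)] -/
theorem AbelianVariety.exists_matrices_trace_pow_singularCohomology_map_eq :
    ∃ M : (k : ℕ) → Matrix (Set.powersetCard (Fin (2 * A.dim)) k) (Set.powersetCard (Fin (2 * A.dim)) k) ℤ,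
      (∀ k n, LinearMap.trace ℚ (singularCohomology ℚ ℚ (ComplexPoints A.X) k)
          ((singularCohomology.map ℚ ℚ φ k).hom ^ n) = ((((M k) ^ n).trace : ℤ) : ℚ)) ∧
      ∀ k, ((singularCohomology.map ℚ ℚ φ k).hom).charpoly = (M k).charpoly.map (Int.castRingHom ℚ) := by
  classical
  choose bZ bQ hb using fun k ↦ exists_basis_toMatrix_singularCohomology_map_eq_map_int A ℚ k
  refine ⟨fun k ↦ LinearMap.toMatrix (bZ k) (bZ k) (singularCohomology.map ℤ ℤ φ k).hom, fun k n ↦ ?_,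
    fun k ↦ ?_⟩
  · rw [LinearMap.trace_eq_matrix_trace ℚ (bQ k), ← LinearMap.toMatrix_pow, hb k φ, ← Matrix.map_pow]
    exact (AddMonoidHom.map_trace (Int.castRingHom ℚ) _).symm
  · rw [← LinearMap.charpoly_toMatrix _ (bQ k), hb k φ, Matrix.charpoly_map]

/-- **The Lefschetz numbers of the iterates form a Lefschetz sequence (Definition 5.1): there are square integer
matrices `P`, `N`, of total size `4^g`, with `Λ(φⁿ) = tr(Pⁿ) - tr(Nⁿ)` for all `n`** (`P = ⊕_{k even} M_k`,
`N = ⊕_{k odd} M_k`, `M_k` the matrix of `φ^*` on `Hᵏ(A(ℂ); ℤ)`; `Σ_k C(2g,k) = 4^g`), for every complex abelian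
variety `A` and every continuous self-map `φ` of `A(ℂ)`; «a Lefschetz sequence if there exist square integer
matrices `A` and `B` such that `a_n = trace Aⁿ - trace Bⁿ`». [cite: ByszewskiGraffWard2021, §5 Def. 5.1 (text chunk p0016)]
[cite: FarmakisMoskowitz2013, §5.5.2 (PDF p. 133)] -/
theorem AbelianVariety.exists_alternatingSum_trace_pow_eq_trace_pow_sub_trace_pow :
    ∃ (ι₁ ι₂ : Type) (_ : Fintype ι₁) (_ : Fintype ι₂) (_ : DecidableEq ι₁) (_ : DecidableEq ι₂)
      (P : Matrix ι₁ ι₁ ℤ) (N : Matrix ι₂ ι₂ ℤ), Fintype.card ι₁ + Fintype.card ι₂ = 4 ^ A.dim ∧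
      ∀ n, ∑ k ∈ range (2 * A.dim + 1), (-1 : ℚ) ^ k *
        LinearMap.trace ℚ (singularCohomology ℚ ℚ (ComplexPoints A.X) k) ((singularCohomology.map ℚ ℚ φ k).hom ^ n) =
          (((P ^ n).trace - (N ^ n).trace : ℤ) : ℚ) := by
  classical
  obtain ⟨M, hM, -⟩ := AbelianVariety.exists_matrices_trace_pow_singularCohomology_map_eq A φ
  refine ⟨(Σ k : {k : Fin (2 * A.dim + 1) // Even (k : ℕ)}, Set.powersetCard (Fin (2 * A.dim)) k.1),
    (Σ k : {k : Fin (2 * A.dim + 1) // ¬Even (k : ℕ)}, Set.powersetCard (Fin (2 * A.dim)) k.1),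
    inferInstance, inferInstance, inferInstance, inferInstance,
    Matrix.blockDiagonal' fun k ↦ M k.1, Matrix.blockDiagonal' fun k ↦ M k.1, ?_, fun n ↦ ?_⟩
  · -- sizes: `Σ_{k even} C(2g,k) + Σ_{k odd} C(2g,k) = 2^{2g} = 4^g`
    rw [Fintype.card_sigma, Fintype.card_sigma, Fintype.sum_subtype_add_sum_subtype (fun k : Fin (2 * A.dim + 1) ↦
      Even (k : ℕ)) (fun k ↦ Fintype.card (Set.powersetCard (Fin (2 * A.dim)) (k : ℕ)))]
    simp_rw [← Nat.card_eq_fintype_card, Set.powersetCard.card, Nat.card_eq_fintype_card, Fintype.card_fin]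
    rw [Fin.sum_univ_eq_sum_range (fun k ↦ (2 * A.dim).choose k), Nat.sum_range_choose, pow_mul]
    norm_num
  · rw [← sum_ite_mul_trace_pow_eq_trace_pow_sub (fun k : Fin (2 * A.dim + 1) ↦ M k) (fun k ↦ Even (k : ℕ)) n,
      Int.cast_sum, ← Fin.sum_univ_eq_sum_range]
    refine sum_congr rfl fun k _ ↦ ?_
    rw [hM, Int.cast_mul]
    congr 1
    rcases Nat.even_or_odd (k : ℕ) with h | h
    · rw [if_pos h, h.neg_one_pow, Int.cast_one]
    · rw [if_neg (Nat.not_even_iff_odd.2 h), h.neg_one_pow, Int.cast_neg, Int.cast_one]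

/-- **The Lefschetz numbers of the iterates satisfy a monic integral linear recurrence of order `4^g`**: there is
a monic `P ∈ ℤ[t]` of degree `4^g` — namely `∏_{k=0}^{2g} χ(φ^* | Hᵏ(A(ℂ); ℤ))`, so that
`P ⊗ ℚ = ∏_{k=0}^{2g} χ(φ^* | Hᵏ(A(ℂ); ℚ))` — with `Σ_{j=0}^{4^g} P_j Λ(φ^{n+j}) = 0` for every `n` (each trace
sequence `Tr((φ^*)ⁿ | Hᵏ) = tr(M_kⁿ)` satisfies the Cayley–Hamilton recurrence of `χ_{M_k}`, hence that of the
product; «its coefficients satisfy a linear recurrence relation … the order of the recurrence is at most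
`max(deg P, deg Q)`»). [cite: ByszewskiGraffWard2021, §5 Prop. 5.2, Lemma 5.3 and Thm. 5.4 (text chunk p0016)] -/
theorem AbelianVariety.exists_monic_sum_coeff_mul_alternatingSum_trace_pow_add_eq_zero :
    ∃ P : ℤ[X], P.Monic ∧ P.natDegree = 4 ^ A.dim ∧
      P.map (Int.castRingHom ℚ) =
        ∏ k ∈ range (2 * A.dim + 1), ((singularCohomology.map ℚ ℚ φ k).hom).charpoly ∧
      ∀ n, ∑ j ∈ range (4 ^ A.dim + 1), (P.coeff j : ℚ) *
        ∑ k ∈ range (2 * A.dim + 1), (-1 : ℚ) ^ k *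
          LinearMap.trace ℚ (singularCohomology ℚ ℚ (ComplexPoints A.X) k)
            ((singularCohomology.map ℚ ℚ φ k).hom ^ (n + j)) = 0 := by
  classical
  obtain ⟨M, hM, hχ⟩ := AbelianVariety.exists_matrices_trace_pow_singularCohomology_map_eq A φ
  have hmonic : (∏ k ∈ range (2 * A.dim + 1), (M k).charpoly).Monic :=
    monic_prod_of_monic _ _ fun k _ ↦ Matrix.charpoly_monic _
  have hdeg : (∏ k ∈ range (2 * A.dim + 1), (M k).charpoly).natDegree = 4 ^ A.dim := by
    rw [natDegree_prod_of_monic _ _ fun k _ ↦ Matrix.charpoly_monic _]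
    simp_rw [Matrix.charpoly_natDegree_eq_dim, ← Nat.card_eq_fintype_card, Set.powersetCard.card,
      Nat.card_eq_fintype_card, Fintype.card_fin]
    rw [Nat.sum_range_choose, pow_mul]
    norm_num
  refine ⟨∏ k ∈ range (2 * A.dim + 1), (M k).charpoly, hmonic, hdeg, ?_, fun n ↦ ?_⟩
  · rw [Polynomial.map_prod]
    exact prod_congr rfl fun k _ ↦ (hχ k).symm
  · -- the recurrence, through `P.map (ℤ → ℚ) = ∏_k χ((M k).map (ℤ → ℚ))`
    set PQ : ℚ[X] := ∏ k ∈ range (2 * A.dim + 1), ((M k).map (Int.castRingHom ℚ)).charpoly with hPQ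
    have hPQ' : (∏ k ∈ range (2 * A.dim + 1), (M k).charpoly).map (Int.castRingHom ℚ) = PQ := by
      rw [hPQ, Polynomial.map_prod]
      exact prod_congr rfl fun k _ ↦ (Matrix.charpoly_map _ _).symm
    have hdegQ : PQ.natDegree = 4 ^ A.dim := by rw [← hPQ', hmonic.natDegree_map, hdeg]
    have hcoeff : ∀ j, ((∏ k ∈ range (2 * A.dim + 1), (M k).charpoly).coeff j : ℚ) = PQ.coeff j := fun j ↦ by
      rw [← hPQ', coeff_map, eq_intCast]
    simp_rw [hcoeff]
    rw [← hdegQ]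
    refine sum_coeff_mul_sum_mul_eq_zero (range (2 * A.dim + 1)) PQ (fun k ↦ (-1 : ℚ) ^ k)
      (fun k m ↦ LinearMap.trace ℚ (singularCohomology ℚ ℚ (ComplexPoints A.X) k)
        ((singularCohomology.map ℚ ℚ φ k).hom ^ m)) (fun k hk m ↦ ?_) n
    rw [hPQ]
    refine sum_coeff_prod_mul_eq_zero (range (2 * A.dim + 1)) (fun i ↦ ((M i).map (Int.castRingHom ℚ)).charpoly)
      (fun i ↦ LinearMap.trace ℚ (singularCohomology ℚ ℚ (ComplexPoints A.X) k)
        ((singularCohomology.map ℚ ℚ φ k).hom ^ i)) hk (fun m' ↦ ?_) m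
    have htr : ∀ i, LinearMap.trace ℚ (singularCohomology ℚ ℚ (ComplexPoints A.X) k)
        ((singularCohomology.map ℚ ℚ φ k).hom ^ i) = (((M k).map (Int.castRingHom ℚ)) ^ i).trace := fun i ↦ by
      rw [hM, ← Matrix.map_pow]
      exact AddMonoidHom.map_trace (Int.castRingHom ℚ) _
    simp_rw [htr, Matrix.charpoly_natDegree_eq_dim]
    exact sum_charpoly_coeff_mul_trace_pow_add _ m'

end Continuous

/-! ## §2 Algebraic self-maps: `F(n) = #Fix(f(ℂ)^[n])` is a Lefschetz sequence, an integral linear recurrence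
sequence of order `4^g`, and an exponential polynomial in the products of the eigenvalues on `H¹` -/

section Headlines

variable (A : AbelianVariety ℂ) (f : A.X ⟶ A.X)

/-- **`F(n) = #Fix(f(ℂ)^[n])` is a Lefschetz sequence (Definition 5.1): `F(n) = tr(Pⁿ) - tr(Nⁿ)` in `ℤ` for all
`n`, for square integer matrices `P`, `N` of total size `4^g`** (`P = ⊕_{k even} [f(ℂ)^* | Hᵏ(A(ℂ); ℤ)]`,
`N = ⊕_{k odd} [f(ℂ)^* | Hᵏ(A(ℂ); ℤ)]`; `F(n) = Λ(f(ℂ)ⁿ)` by row Q616, `#Fix = Nat.card`, `0` when infinite), for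
every complex abelian variety `A` and every `ℂ`-morphism `f : A.X ⟶ A.X`.
[cite: ByszewskiGraffWard2021, §5 Def. 5.1 (text chunk p0016)] [cite: AlvaradoAuffarth2018, §1 (arXiv PDF p. 3)] -/
theorem AbelianVariety.exists_natCard_fixedPoints_iterate_eq_trace_pow_sub_trace_pow :
    ∃ (ι₁ ι₂ : Type) (_ : Fintype ι₁) (_ : Fintype ι₂) (_ : DecidableEq ι₁) (_ : DecidableEq ι₂)
      (P : Matrix ι₁ ι₁ ℤ) (N : Matrix ι₂ ι₂ ℤ), Fintype.card ι₁ + Fintype.card ι₂ = 4 ^ A.dim ∧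
      ∀ n, (Nat.card (fixedPoints (AlgPoints.mapContinuous (L := ℂ) f)^[n]) : ℤ) =
        (P ^ n).trace - (N ^ n).trace := by
  obtain ⟨ι₁, ι₂, _, _, _, _, P, N, hcard, h⟩ :=
    AbelianVariety.exists_alternatingSum_trace_pow_eq_trace_pow_sub_trace_pow A (AlgPoints.mapContinuous (L := ℂ) f)
  refine ⟨ι₁, ι₂, inferInstance, inferInstance, inferInstance, inferInstance, P, N, hcard, fun n ↦ ?_⟩
  have h' : ((Nat.card (fixedPoints (AlgPoints.mapContinuous (L := ℂ) f)^[n]) : ℤ) : ℚ) =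
      (((P ^ n).trace - (N ^ n).trace : ℤ) : ℚ) := by
    rw [Int.cast_natCast, AbelianVariety.natCard_fixedPoints_iterate_eq_alternatingSum_trace_pow, h n]
  exact_mod_cast h'

/-- **`F(n) = #Fix(f(ℂ)^[n])` satisfies a monic integral linear recurrence of order `4^g`**: `Σ_{j=0}^{4^g} P_j
F(n + j) = 0` in `ℤ` for all `n`, with `P ∈ ℤ[t]` monic of degree `4^g` and `P ⊗ ℚ = ∏_{k=0}^{2g} χ(f(ℂ)^* |
Hᵏ(A(ℂ); ℚ))` (Cayley–Hamilton on each `Hᵏ(A(ℂ); ℤ)`; `F(n) = Λ(f(ℂ)ⁿ)`, row Q616).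
[cite: ByszewskiGraffWard2021, §5 Lemma 5.3 and Thm. 5.4 (text chunk p0016)] [cite: AlvaradoAuffarth2018, §1 (arXiv PDF p. 3)] -/
theorem AbelianVariety.exists_monic_sum_coeff_mul_natCard_fixedPoints_iterate_add_eq_zero :
    ∃ P : ℤ[X], P.Monic ∧ P.natDegree = 4 ^ A.dim ∧
      P.map (Int.castRingHom ℚ) = ∏ k ∈ range (2 * A.dim + 1),
        ((singularCohomology.map ℚ ℚ (AlgPoints.mapContinuous (L := ℂ) f) k).hom).charpoly ∧
      ∀ n, ∑ j ∈ range (4 ^ A.dim + 1),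
        P.coeff j * (Nat.card (fixedPoints (AlgPoints.mapContinuous (L := ℂ) f)^[n + j]) : ℤ) = 0 := by
  obtain ⟨P, hmonic, hdeg, hmap, h⟩ :=
    AbelianVariety.exists_monic_sum_coeff_mul_alternatingSum_trace_pow_add_eq_zero A
      (AlgPoints.mapContinuous (L := ℂ) f)
  refine ⟨P, hmonic, hdeg, hmap, fun n ↦ ?_⟩
  have h' : ((∑ j ∈ range (4 ^ A.dim + 1),
      P.coeff j * (Nat.card (fixedPoints (AlgPoints.mapContinuous (L := ℂ) f)^[n + j]) : ℤ) : ℤ) : ℚ) = 0 := by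
    rw [← h n]
    push_cast
    exact sum_congr rfl fun j _ ↦ by
      rw [AbelianVariety.natCard_fixedPoints_iterate_eq_alternatingSum_trace_pow]
  exact_mod_cast h'

/-- **`F(n) = Σ_{S} (-1)^{|S|} (α_S)ⁿ`, an exponential polynomial in the products `α_S = ∏_{i ∈ S} αᵢ` of the
eigenvalues `α₁, …, α_{2g} ∈ ℂ` of `f(ℂ)^*` on `H¹(A(ℂ); ℚ)`** — the sum over all sub-multisets `S` of the
eigenvalue multiset (Proposition 5.2's form «`a_n = Σᵢ mᵢ λᵢⁿ`» with `λ = α_S` and `m = ±1`), by expanding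
«`F(n) = Δ_n(χ^r_f)`», `F(n) = ∏ᵢ (1 - αᵢⁿ)` (row Q643), for all `n`.
[cite: ByszewskiGraffWard2021, §5 Prop. 5.2 (text chunk p0016)] [cite: AlvaradoAuffarth2018, §1 eq. (1) and §3 (arXiv PDF pp. 3, 6)] -/
theorem AbelianVariety.natCard_fixedPoints_iterate_eq_sum_powerset_eigenvalues (n : ℕ) :
    (Nat.card (fixedPoints (AlgPoints.mapContinuous (L := ℂ) f)^[n]) : ℂ) =
      ((FrobeniusCharpoly.eigenvalues ℂ
          (singularCohomology.map ℚ ℚ (AlgPoints.mapContinuous (L := ℂ) f) 1).hom).powerset.map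
        fun t ↦ (-1 : ℂ) ^ Multiset.card t * t.prod ^ n).sum := by
  classical
  rw [AbelianVariety.natCard_fixedPoints_iterate_eq_prod_one_sub_pow_eigenvalues]
  set α := FrobeniusCharpoly.eigenvalues ℂ
    (singularCohomology.map ℚ ℚ (AlgPoints.mapContinuous (L := ℂ) f) 1).hom
  have h1 : (α.map fun a ↦ 1 - a ^ n) = α.map fun a ↦ (1 : ℂ) + -(a ^ n) := by
    simp_rw [sub_eq_add_neg]
  rw [h1, Multiset.prod_map_add, Multiset.antidiagonal_eq_map_powerset, Multiset.map_map]
  refine congrArg _ (Multiset.map_congr rfl fun t _ ↦ ?_)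
  rw [Function.comp_apply, Multiset.map_const', Multiset.prod_replicate, one_pow, one_mul,
    show (t.map fun a ↦ -(a ^ n)) = (t.map fun a ↦ a ^ n).map Neg.neg by rw [Multiset.map_map]; rfl,
    Multiset.prod_map_neg, Multiset.card_map, Multiset.prod_map_pow, Multiset.map_id']

end Headlines

end Literature.AlgebraicGeometry.HodgeTheory
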